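import Literature.MathematicalPhysics.QuantumLattice.VariationalEquilibriumCoexistenceInterval
import Literature.MathematicalPhysics.QuantumLattice.LayerMarginalsAndPlaneStacks
import HarnessLib

/-!
# The ENERGY coexistence interval at a temperature: the energies of the equilibrium states of any finite-range lattice-fermion model
# at inverse temperature `β` fill EXACTLY the interval between the one-sided `β`-derivatives of the pressure (latent heat / lever rule)

Topic `MathematicalPhysics/QuantumLattice` (model-free; stage S2 (iii) `T > 0`, the `T` axis of the phase map). The temperature is a coupling direction:
for the TEMPERATURE PENCIL `b ↦ linearFamily (nullInteraction d) ![Ψ] ![b] = b·Ψ` one has `e_{b·Ψ}(ω) = b·e_Ψ(ω)`, `P(1, b·Ψ) = P(b, Ψ)` and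
`ω` is an equilibrium at `(1, b·Ψ)` iff at `(b, Ψ)` (§1); hence `VariationalEquilibriumCoexistenceInterval` (conjugate densities of the equilibria fill
the subdifferential of the directional pressure) and `VariationalEquilibriumTangentRealisation` apply to the direction `β` (§2). With `s_k = 1/(k+1)`,
`D₊(β) = ⨅_k (P(β+s_k) − P(β))/s_k`, `D₋(β) = ⨆_k (P(β) − P(β−s_k))/s_k` (`P(b) = Ψ.varPressure b R`, convex in `b`):

* `IsVarEquilibrium.neg_meanEnergy_mem_Icc_oneSided_beta`: every equilibrium `ω` at `β` has `−e_Ψ(ω) ∈ [D₋(β), D₊(β)]`;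
* **`exists_isVarEquilibrium_neg_meanEnergy_eq_of_mem_Icc_beta`**: every `x ∈ [D₋(β), D₊(β)]` is `−e_Ψ(ω)` for an equilibrium `ω` at `β` (`d ≥ 1`).

So **the energy densities of the equilibrium states at `β` form exactly `[−D₊(β), −D₋(β)]`**: at a first-order transition in the temperature the
whole latent-heat interval is carried by (translation-invariant, infinite-volume) equilibrium states, and certified pressures at `β ± s` bound it from
outside (chords) — the thermodynamic-limit content of the thermal crew's energy windows from three pressures, now with realising STATES.

HONEST SCOPE: existence/characterisation; no uniqueness, no certificate value, no phase word, no definition. Everything PROVED, 0 sorry.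

## Mathlib / tree search
REUSED: `nullInteraction`, `InfVolFermionState.meanEnergy_nullInteraction`, `meanEnergy_linearFamily`, `FermionInteraction.varPressure_le`,
`sub_mul_le_varPressure`, `IsVarEquilibrium.neg_mul_meanEnergy_mem_Icc_oneSided`, `exists_isVarEquilibrium_neg_mul_meanEnergy_eq_of_mem_Icc`;
Mathlib `Fin.sum_univ_one`, `iInf_congr`, `iSup_congr`.

## References
* R. B. Israel, *Convexity in the Theory of Lattice Gases* (1979), Thm. I.2.4, §V.1. [cite: Israel1979, Thm. I.2.4]
* D. Ruelle, *Statistical Mechanics: Rigorous Results* (1969), §3.4. [cite: Ruelle1969, §3.4]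
-/

noncomputable section

namespace Literature.MathematicalPhysics.QuantumLattice

open _root_.Filter Set InfVolFermionState
open scoped _root_.Topology

section Temperature

variable {d : ℕ} (Ψ : FermionInteraction d) (R : ℝ)

/-! ### §1 The temperature pencil `b ↦ b·Ψ` -/

/-- `e_{b·Ψ}(ω) = b · e_Ψ(ω)` for the temperature pencil `linearFamily 0 ![Ψ] ![b]`. [cite: Israel1979, Thm. I.2.4] -/
theorem InfVolFermionState.meanEnergy_temperaturePencil (ω : InfVolFermionState d) (b : ℝ) :
    ω.meanEnergy (FermionInteraction.linearFamily (nullInteraction d) ![Ψ] ![b]) R = b * ω.meanEnergy Ψ R := by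
  rw [ω.meanEnergy_linearFamily, ω.meanEnergy_nullInteraction, Fin.sum_univ_one]
  simp

/-- Shifting the pencil parameter: `![b] + 1_0·δ = ![b + δ]`. [folklore] -/
private theorem temperaturePencil_shift (b δ : ℝ) : (![b] : Fin 1 → ℝ) + Pi.single 0 δ = ![b + δ] := by
  ext i
  fin_cases i
  simp

/-- **`P(1, b·Ψ) = P(b, Ψ)`** (the same variational functional). [cite: Israel1979, Thm. I.2.4] -/
theorem varPressure_temperaturePencil (b : ℝ) :
    (FermionInteraction.linearFamily (nullInteraction d) ![Ψ] ![b]).varPressure 1 R = Ψ.varPressure b R := by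
  refine le_antisymm ?_ ?_
  · refine (FermionInteraction.linearFamily (nullInteraction d) ![Ψ] ![b]).varPressure_le 1 R fun ω hω => ?_
    rw [ω.meanEnergy_temperaturePencil, one_mul]
    exact Ψ.sub_mul_le_varPressure b R hω
  · refine Ψ.varPressure_le b R fun ω hω => ?_
    have h := (FermionInteraction.linearFamily (nullInteraction d) ![Ψ] ![b]).sub_mul_le_varPressure 1 R hω
    rw [ω.meanEnergy_temperaturePencil, one_mul] at h
    exact h

/-- **Equilibrium at `(1, b·Ψ)` iff at `(b, Ψ)`.** [cite: Israel1979, Thm. I.2.4] -/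
theorem isVarEquilibrium_temperaturePencil_iff (b : ℝ) (ω : InfVolFermionState d) :
    ω.IsVarEquilibrium 1 (FermionInteraction.linearFamily (nullInteraction d) ![Ψ] ![b]) R ↔ ω.IsVarEquilibrium b Ψ R := by
  constructor
  · rintro ⟨hTI, h⟩
    refine ⟨hTI, ?_⟩
    rw [ω.meanEnergy_temperaturePencil, one_mul, varPressure_temperaturePencil] at h
    exact h
  · rintro ⟨hTI, h⟩
    refine ⟨hTI, ?_⟩
    rw [ω.meanEnergy_temperaturePencil, one_mul, varPressure_temperaturePencil]
    exact h

/-- The shifted pencil pressures are the pressures at shifted temperature. [cite: Israel1979, Thm. I.2.4] -/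
theorem varPressure_temperaturePencil_shift (b δ : ℝ) :
    (FermionInteraction.linearFamily (nullInteraction d) ![Ψ] ((![b] : Fin 1 → ℝ) + Pi.single 0 δ)).varPressure 1 R = Ψ.varPressure (b + δ) R := by
  rw [temperaturePencil_shift, varPressure_temperaturePencil]

/-! ### §2 The energy coexistence interval -/

/-- **Every equilibrium's energy lies in the one-sided interval**: `D₋(β) ≤ −e_Ψ(ω) ≤ D₊(β)` for every equilibrium `ω` at `(β, Ψ)` (every real `β`).
[cite: Israel1979, Thm. I.2.4] -/
theorem IsVarEquilibrium.neg_meanEnergy_mem_Icc_oneSided_beta {β : ℝ} {ω : InfVolFermionState d} (hω : ω.IsVarEquilibrium β Ψ R) :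
    -ω.meanEnergy Ψ R ∈ Set.Icc
      (⨆ k : ℕ, (Ψ.varPressure β R - Ψ.varPressure (β + -(1 / ((k : ℝ) + 1))) R) / (1 / ((k : ℝ) + 1)))
      (⨅ k : ℕ, (Ψ.varPressure (β + 1 / ((k : ℝ) + 1)) R - Ψ.varPressure β R) / (1 / ((k : ℝ) + 1))) := by
  have hω' := (isVarEquilibrium_temperaturePencil_iff Ψ R β ω).2 hω
  have h := IsVarEquilibrium.neg_mul_meanEnergy_mem_Icc_oneSided 1 (nullInteraction d) ![Ψ] R ![β] 0 hω'
  simp only [varPressure_temperaturePencil_shift, varPressure_temperaturePencil, Matrix.cons_val_zero, one_mul] at h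
  exact h

variable (hd : 0 < d)
include hd

/-- **THE ENERGY COEXISTENCE INTERVAL IS FILLED BY EQUILIBRIUM STATES**: for every `x` with `D₋(β) ≤ x ≤ D₊(β)` (the one-sided `β`-derivatives of
`b ↦ P(b, Ψ, R)`) there is a variational equilibrium state `ω` at `(β, Ψ)` with `−e_Ψ(ω) = x` (`d ≥ 1`, every real `β`). With the previous theorem
the energies of the equilibrium states at `β` form exactly `[−D₊(β), −D₋(β)]`. [cite: Israel1979, Thm. I.2.4] -/
theorem exists_isVarEquilibrium_neg_meanEnergy_eq_of_mem_Icc_beta {β x : ℝ}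
    (hlo : (⨆ k : ℕ, (Ψ.varPressure β R - Ψ.varPressure (β + -(1 / ((k : ℝ) + 1))) R) / (1 / ((k : ℝ) + 1))) ≤ x)
    (hhi : x ≤ ⨅ k : ℕ, (Ψ.varPressure (β + 1 / ((k : ℝ) + 1)) R - Ψ.varPressure β R) / (1 / ((k : ℝ) + 1))) :
    ∃ ω : InfVolFermionState d, ω.IsVarEquilibrium β Ψ R ∧ -ω.meanEnergy Ψ R = x := by
  have hlo' : (⨆ k : ℕ, ((FermionInteraction.linearFamily (nullInteraction d) ![Ψ] ![β]).varPressure 1 R -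
      (FermionInteraction.linearFamily (nullInteraction d) ![Ψ] ((![β] : Fin 1 → ℝ) + Pi.single 0 (-(1 / ((k : ℝ) + 1))))).varPressure 1 R) /
        (1 / ((k : ℝ) + 1))) ≤ x := by
    simp only [varPressure_temperaturePencil_shift, varPressure_temperaturePencil]
    exact hlo
  have hhi' : x ≤ ⨅ k : ℕ, ((FermionInteraction.linearFamily (nullInteraction d) ![Ψ] ((![β] : Fin 1 → ℝ) + Pi.single 0 (1 / ((k : ℝ) + 1)))).varPressure 1 R -
      (FermionInteraction.linearFamily (nullInteraction d) ![Ψ] ![β]).varPressure 1 R) / (1 / ((k : ℝ) + 1)) := by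
    simp only [varPressure_temperaturePencil_shift, varPressure_temperaturePencil]
    exact hhi
  obtain ⟨ω, hω, he⟩ := exists_isVarEquilibrium_neg_mul_meanEnergy_eq_of_mem_Icc 1 (nullInteraction d) ![Ψ] R ![β] 0 hd hlo' hhi'
  refine ⟨ω, (isVarEquilibrium_temperaturePencil_iff Ψ R β ω).1 hω, ?_⟩
  simp only [Matrix.cons_val_zero, one_mul] at he
  exact he

/-- The interval is nonempty: `D₋(β) ≤ D₊(β)` (convexity of `b ↦ P(b,Ψ)`; realised by an equilibrium). [cite: Israel1979, Thm. I.2.4] -/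
theorem leftDeriv_le_rightDeriv_varPressure_beta (β : ℝ) :
    (⨆ k : ℕ, (Ψ.varPressure β R - Ψ.varPressure (β + -(1 / ((k : ℝ) + 1))) R) / (1 / ((k : ℝ) + 1))) ≤
      ⨅ k : ℕ, (Ψ.varPressure (β + 1 / ((k : ℝ) + 1)) R - Ψ.varPressure β R) / (1 / ((k : ℝ) + 1)) := by
  obtain ⟨ω, hω⟩ := Ψ.exists_isVarEquilibrium hd β R
  obtain ⟨h1, h2⟩ := IsVarEquilibrium.neg_meanEnergy_mem_Icc_oneSided_beta Ψ R hω
  exact h1.trans h2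

end Temperature

end Literature.MathematicalPhysics.QuantumLattice
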